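import Mathlib.Tactic.FinCases
import Literature.Barriers.SmoothPoincare4.PropertyTwoRAndrewsCurtisACMoves
import HarnessLib

/-!
# Barrier (SmoothPoincare4) `PropertyTwoRAndrewsCurtis`: `n ≤ 2`, and the barriers are exactly GST's §7 implication

Proofs companion (theorems only: no definition, no named fact) of
`Literature/Barriers/SmoothPoincare4/PropertyTwoRAndrewsCurtis.lean` — Gompf–Scharlemann–Thompson
2010 (= GST), §7: the printed Property 2R would force Andrews–Curtis triviality of the
presentations `gstPresentation n = ⟨x, y ∣ yxy = xyx, xⁿ⁺¹ = yⁿ⟩` — and of its first proofs sibling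
`PropertyTwoRAndrewsCurtisACMoves.lean`.

The barrier file carries two barrier statements of the shape
`AKPresentationsACNontrivial → ¬ (Property 2R)` with
`AKPresentationsACNontrivial = ∃ n ≥ 3, ¬ AC-trivial (gstPresentation n)`: the original
`PropertyTwoRBarrier` (over the permissive `PropertyTwoRConjecture`; over-states the source — Errata
there — and is proved from the equally over-stated named fact `gst2010_propertyTwoR_andrewsCurtis`,
`propertyTwoRBarrier_of_gst`; all three are `@[deprecated]` since the named-fact verdict clean-up
of 2026-08-15, "Deprecation" in the barrier file's module docstring) and the corrected
`StrictPropertyTwoRBarrier` (over the printed `StrictPropertyTwoRConjecture`; THE catalogue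
entry), derived there (`strictPropertyTwoRBarrier_of_gst`) from GST's §7
implication **"printed Property 2R ⇒ every `⟨x, y ∣ yxy = xyx, xⁿ⁺¹ = yⁿ⟩` is Andrews–Curtis
trivial"**, i.e. `StrictPropertyTwoRConjecture → ∀ n, IsAndrewsCurtisEquivalent (gstPresentation n)
(BalancedPresentation.trivial 2)` ("If the 2-component link `L_{n,k}` … can be changed to the unlink
by handle slides, then the dual slides in Figure 9 will trivialize that picture, showing that the
above presentation is Andrews-Curtis trivial", surgery on `L_{n,1}` being `#₂(S¹ × S²)` "by
construction"). Here the relations are closed up: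

* `isAndrewsCurtisEquivalent_gstPresentation_zero_trivial`, `…_one_trivial`, `…_two_trivial`,
  `isAndrewsCurtisEquivalent_gstPresentation_trivial_of_le_two` — **for `n ≤ 2` the presentations
  ARE Andrews–Curtis trivial**, as GST §8 print ("In each of the special cases [`n = 0, 1`, `k = 0`,
  `(n, k) = (2, 1)`], the corresponding presentation is Andrews-Curtis trivial. (This is clear
  except for the last case, which is due to Gersten [Ge] …)"): explicit sequences of the three
  Andrews–Curtis moves of `Literature.Topology.FourManifolds.AndrewsCurtisMove` (4, 15 and 23
  moves; the one for `n = 2`, i.e. for the Akbulut–Kirby presentation `AK(2) = ⟨x, y ∣ x² = y³,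
  xyx = yxy⟩` up to `x ↔ y` — `isAndrewsCurtisEquivalent_akbulutKirby_zero_trivial` — was found by
  breadth-first search over relators of length `≤ 9` and is checked move by move by the kernel;
  GST reproduce Gersten's trivialisation, which uses a change of free basis instead);
* `akPresentationsACNontrivial_iff_exists` — hence the bound `3 ≤ n` in the barrier's hypothesis
  is automatic: `AKPresentationsACNontrivial ↔ ∃ n, ¬ AC-trivial (gstPresentation n)`;
* `strictPropertyTwoRBarrier_iff_gst`, `propertyTwoRBarrier_iff_gst` — **each barrier statement
  is EQUIVALENT to the §7 implication over the same Property 2R** (the corrected one to the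
  implication displayed above, the original one to `gst2010_propertyTwoR_andrewsCurtis`;
  `propertyTwoRBarrier_iff_gst` relates two deprecated statements, is deprecated with them —
  2026-08-15 — and switches `linter.deprecated` off for itself alone). So an
  unconditional `StrictPropertyTwoRBarrier_holds` is exactly a proof of GST's printed §7
  implication, and conversely: the corrected entry has ONE proof obligation — the barrier
  statement and the implication stand or fall together — and the implication, whenever it is
  wanted as such under the barrier as hypothesis, is `strictPropertyTwoRBarrier_iff_gst.1`;
* `not_strictGeneralizedPropertyR_of_barrier` — the barrier together with Andrews–Curtis
  nontriviality of any one `gstPresentation n` refutes the printed generalised Property R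
  conjecture.

## Why `StrictPropertyTwoRBarrier` (equivalently, GST's §7 implication) is not discharged here (triage `XL`; reviews of 2026-08-15)

By `strictPropertyTwoRBarrier_iff_gst` a proof of the barrier is a proof of
`StrictPropertyTwoRConjecture → ∀ n, IsAndrewsCurtisEquivalent (gstPresentation n) (trivial 2)`,
and `Literature.Topology.FourManifolds.StrictPropertyTwoRConjecture` quantifies over genuine framed
links `FramedLink (Fin 2)` (smooth embeddings `S¹ → S³`) whose surgery `Y` satisfies
`IsSphereTwoProdCircleSum 2 Y`. Any proof must therefore exhibit, for each `n ≥ 3`, an explicit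
smooth 2-component framed link realising the presentation — GST's `L_{n,1} = Q ⊔ V_n` (square knot
interleaved with `T_{n,n+1} # mirror`, GST §1 and §7) or another attaching link of the 2-handles of
the upside-down Akbulut–Kirby ball — together with: (A) the identification of its `0`-framed surgery
with `#²(S² × S¹)` in the tree's `IsConnectedSum` sense ("by construction" in GST §7, i.e. through
Gompf's Kirby-calculus reduction [Go1] of the handlebody to `S³`; compare the `0`-framed UNLINK,
whose surgery is identified only in `KirbyCalculusUnlinkProofs.lean`, and note that even the
soundness of strict Kirby moves, `StrictKirbyEquivalent.nonempty_diffeomorph`, is a named fact of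
`KirbyMovesStrictHandleSlide.lean`, taken as a hypothesis in `KirbyCalculusStrict.lean` and reduced
to its leaves by `StrictKirbyEquivalent.nonempty_diffeomorph_of_leaves`); (B) the meridian
presentation of `π₁` of a surgered
manifold over the tree's gluing predicates (van Kampen for `Link.IsSurgeryPresentation`, meridians
normally generating the link group, `π₁(#²(S² × S¹))` free of rank `2`) and its invariance, up to
Andrews–Curtis moves and a change of free basis, under STRICT handle slides (GST §7, "the dual
slide … multiplying `rⱼ` by a conjugate of `rᵢ`"); (C) the computation of that presentation for
`L_{n,1}` from Gompf's diagram (GST Figure 9 and [Go1]). None of (A)–(C) is in Mathlib or the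
tree beyond general tools (van Kampen for closed covers, `π₁` of the circle and the torus, cell
attachments — `Literature/AlgebraicTopology/FundamentalGroup/`; Dehn surgery, band sums and the
Kirby moves themselves — `Literature/Topology/FourManifolds/`); each is a theory-sized
formalisation. The one algebraic input, that Andrews–Curtis
TRIVIALITY is insensitive to changes of free basis, IS in the tree and unconditional since
Nielsen's theorem was discharged (`Literature.Topology.FourManifolds.autFreeGroup_eq_closure_nielsen_holds`,
`isAndrewsCurtisEquivalent_mulAut_comp_trivial_iff'`, `BalancedPresentationBasisChangeProofs.lean`).
Under the fact discipline (D-0026) no further named fact is minted: the trust base of the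
corrected barrier entry is {`StrictPropertyTwoRBarrier`} itself — by
`strictPropertyTwoRBarrier_iff_gst` the same thing as GST's printed §7 implication — (resp. the
over-stated {`PropertyTwoRBarrier`} ↔ {`gst2010_propertyTwoR_andrewsCurtis`} for the original
declarations, both deprecated as named facts since 2026-08-15).

## References

* R. E. Gompf, M. Scharlemann, A. Thompson, *Fibered knots and potential counterexamples to the
  Property 2R and Slice-Ribbon Conjectures*, Geom. Topol. 14 (2010) 2305–2347, §1, §7, §8
  (arXiv:1103.1601 pp. 3, 16–18). [GompfScharlemannThompson2010]
* S. Akbulut, R. Kirby, Topology 24 (1985), §1. [AkbulutKirby1985]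
* J. J. Andrews, M. L. Curtis, Proc. AMS 16 (1965). [AndrewsCurtis1965]
* R. Gompf, *Killing the Akbulut–Kirby 4-sphere*, Topology 30 (1991). [Gompf1991Killing]
-/

noncomputable section

namespace Literature.Barriers.SmoothPoincare4

open Function Literature.Topology.FourManifolds

/-! ### The three Andrews–Curtis moves on a two-relator presentation `![u, v]`

Matrix-literal forms of the generating moves (and of conjugation by a word and the transposition
of the relators, which are Andrews–Curtis equivalences by `BalancedPresentationMoves.lean`), each
"up to a free-group identity" `h`, discharged by default (auto-param) by free reduction of both sides
(`simp only` with associativity, `mul_inv_rev` and the cancellation lemmas), so that a move sequence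
is replayed by naming the new relator at each step (below, `x` and `y` are local abbreviations,
introduced with `set`, for the generators `FreeGroup.of 0` and `FreeGroup.of 1`). -/

section Moves

variable {u v u' v' : FreeGroup (Fin 2)}

/-- Move `r₀ ↦ r₀⁻¹` on `![u, v]`. [cite: AndrewsCurtis1965] -/
private theorem acInv0
    (h : u' = u⁻¹ := by
      simp only [mul_assoc, mul_inv_rev, inv_inv, inv_one, mul_inv_cancel_left,
        inv_mul_cancel_left, mul_inv_cancel, inv_mul_cancel, mul_one, one_mul, pow_succ, pow_zero]) :
    IsAndrewsCurtisEquivalent ![u, v] ![u', v] := by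
  convert IsAndrewsCurtisEquivalent.update_inv ![u, v] 0 using 2
  ext i; fin_cases i <;> simp [h]

/-- Move `r₁ ↦ r₁⁻¹` on `![u, v]`. [cite: AndrewsCurtis1965] -/
private theorem acInv1
    (h : v' = v⁻¹ := by
      simp only [mul_assoc, mul_inv_rev, inv_inv, inv_one, mul_inv_cancel_left,
        inv_mul_cancel_left, mul_inv_cancel, inv_mul_cancel, mul_one, one_mul, pow_succ, pow_zero]) :
    IsAndrewsCurtisEquivalent ![u, v] ![u, v'] := by
  convert IsAndrewsCurtisEquivalent.update_inv ![u, v] 1 using 2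
  ext i; fin_cases i <;> simp [h]

/-- Move `r₀ ↦ r₀ r₁` on `![u, v]`. [cite: AndrewsCurtis1965] -/
private theorem acMul0
    (h : u' = u * v := by
      simp only [mul_assoc, mul_inv_rev, inv_inv, inv_one, mul_inv_cancel_left,
        inv_mul_cancel_left, mul_inv_cancel, inv_mul_cancel, mul_one, one_mul, pow_succ, pow_zero]) :
    IsAndrewsCurtisEquivalent ![u, v] ![u', v] := by
  convert IsAndrewsCurtisEquivalent.update_mul ![u, v] (i := 0) (j := 1) (by decide) using 2
  ext i; fin_cases i <;> simp [h]

/-- Move `r₁ ↦ r₁ r₀` on `![u, v]`. [cite: AndrewsCurtis1965] -/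
private theorem acMul1
    (h : v' = v * u := by
      simp only [mul_assoc, mul_inv_rev, inv_inv, inv_one, mul_inv_cancel_left,
        inv_mul_cancel_left, mul_inv_cancel, inv_mul_cancel, mul_one, one_mul, pow_succ, pow_zero]) :
    IsAndrewsCurtisEquivalent ![u, v] ![u, v'] := by
  convert IsAndrewsCurtisEquivalent.update_mul ![u, v] (i := 1) (j := 0) (by decide) using 2
  ext i; fin_cases i <;> simp [h]

/-- Conjugation `r₀ ↦ c r₀ c⁻¹` by a word `c` on `![u, v]` (a composite of moves
`rᵢ ↦ x rᵢ x⁻¹`, `IsAndrewsCurtisEquivalent.update_conj`). [folklore] -/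
private theorem acConj0 (c : FreeGroup (Fin 2))
    (h : u' = c * u * c⁻¹ := by
      simp only [mul_assoc, mul_inv_rev, inv_inv, inv_one, mul_inv_cancel_left,
        inv_mul_cancel_left, mul_inv_cancel, inv_mul_cancel, mul_one, one_mul, pow_succ, pow_zero]) :
    IsAndrewsCurtisEquivalent ![u, v] ![u', v] := by
  convert IsAndrewsCurtisEquivalent.update_conj ![u, v] 0 c using 2
  ext i; fin_cases i <;> simp [h]

/-- Conjugation `r₁ ↦ c r₁ c⁻¹` by a word `c` on `![u, v]`. [folklore] -/
private theorem acConj1 (c : FreeGroup (Fin 2))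
    (h : v' = c * v * c⁻¹ := by
      simp only [mul_assoc, mul_inv_rev, inv_inv, inv_one, mul_inv_cancel_left,
        inv_mul_cancel_left, mul_inv_cancel, inv_mul_cancel, mul_one, one_mul, pow_succ, pow_zero]) :
    IsAndrewsCurtisEquivalent ![u, v] ![u, v'] := by
  convert IsAndrewsCurtisEquivalent.update_conj ![u, v] 1 c using 2
  ext i; fin_cases i <;> simp [h]

/-- Transposing the two relators, `![u, v] ↝ ![v, u]` (seven moves,
`IsAndrewsCurtisEquivalent.comp_swap`). [folklore] -/
private theorem acSwap : IsAndrewsCurtisEquivalent ![u, v] ![v, u] := by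
  convert IsAndrewsCurtisEquivalent.comp_swap ![u, v] 0 1 using 2
  ext i; fin_cases i <;> simp

end Moves

/-! ### `n ≤ 2`: the presentations are Andrews–Curtis trivial (GST §8) -/

/-- The trivial presentation on two generators is `![x, y]`. [folklore] -/
private theorem trivial_two_eq :
    BalancedPresentation.trivial 2 = ![FreeGroup.of 0, FreeGroup.of 1] := by
  ext i; fin_cases i <;> rfl

/-- **`n = 0`: `⟨x, y ∣ yxy = xyx, x = 1⟩` is Andrews–Curtis trivial** ("clear", GST §8):
four moves — conjugate `r₀`, multiply it by `r₁ = x` to get a conjugate of `y`, conjugate, swap.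
[cite: GompfScharlemannThompson2010, §8] -/
theorem isAndrewsCurtisEquivalent_gstPresentation_zero_trivial :
    IsAndrewsCurtisEquivalent (gstPresentation 0) (BalancedPresentation.trivial 2) := by
  set x : FreeGroup (Fin 2) := FreeGroup.of 0
  set y : FreeGroup (Fin 2) := FreeGroup.of 1
  have e : gstPresentation 0 = ![y * x * y * (x * y * x)⁻¹, x ^ (0 + 1) * (y ^ 0)⁻¹] := rfl
  have fin : BalancedPresentation.trivial 2 = ![x, y] := trivial_two_eq
  rw [e, fin]
  refine IsAndrewsCurtisEquivalent.trans (acConj0 (y * x * y⁻¹ * x⁻¹ * y⁻¹) (u' := x⁻¹ * y * x * y * x⁻¹ * y⁻¹)) ?_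
  refine IsAndrewsCurtisEquivalent.trans (acMul0 (u' := x⁻¹ * y * x * y * x⁻¹ * y⁻¹ * x)) ?_
  refine IsAndrewsCurtisEquivalent.trans (acConj0 (x⁻¹ * y⁻¹ * x) (u' := y)) ?_
  refine IsAndrewsCurtisEquivalent.trans acSwap ?_
  exact IsAndrewsCurtisEquivalent.refl _
/-- **`n = 1`: `⟨x, y ∣ yxy = xyx, x² = y⟩` is Andrews–Curtis trivial** ("clear", GST §8:
substituting `y = x²` turns the braid relator into `x`): an explicit sequence of 15 moves
(relators of length `≤ 7` throughout), found by breadth-first search and checked by the kernel.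
[cite: GompfScharlemannThompson2010, §8] -/
theorem isAndrewsCurtisEquivalent_gstPresentation_one_trivial :
    IsAndrewsCurtisEquivalent (gstPresentation 1) (BalancedPresentation.trivial 2) := by
  set x : FreeGroup (Fin 2) := FreeGroup.of 0
  set y : FreeGroup (Fin 2) := FreeGroup.of 1
  have e : gstPresentation 1 = ![y * x * y * (x * y * x)⁻¹, x ^ (1 + 1) * (y ^ 1)⁻¹] := rfl
  have fin : BalancedPresentation.trivial 2 = ![x, y] := trivial_two_eq
  rw [e, fin]
  refine IsAndrewsCurtisEquivalent.trans (acInv1 (v' := y * x⁻¹ * x⁻¹)) ?_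
  refine IsAndrewsCurtisEquivalent.trans (acConj1 (x * y⁻¹) (v' := x⁻¹ * y * x⁻¹)) ?_
  refine IsAndrewsCurtisEquivalent.trans (acConj0 (x⁻¹ * y⁻¹) (u' := y * x⁻¹ * y⁻¹ * x⁻¹ * y * x)) ?_
  refine IsAndrewsCurtisEquivalent.trans (acMul0 (u' := y * x⁻¹ * y⁻¹ * x⁻¹ * y * y * x⁻¹)) ?_
  refine IsAndrewsCurtisEquivalent.trans (acInv0 (u' := x * y⁻¹ * y⁻¹ * x * y * x * y⁻¹)) ?_
  refine IsAndrewsCurtisEquivalent.trans (acConj0 (x⁻¹) (u' := y⁻¹ * y⁻¹ * x * y * x * y⁻¹ * x)) ?_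
  refine IsAndrewsCurtisEquivalent.trans (acMul0 (u' := y⁻¹ * y⁻¹ * x * y)) ?_
  refine IsAndrewsCurtisEquivalent.trans (acConj0 (y) (u' := y⁻¹ * x)) ?_
  refine IsAndrewsCurtisEquivalent.trans (acMul1 (v' := x⁻¹ * y * x⁻¹ * y⁻¹ * x)) ?_
  refine IsAndrewsCurtisEquivalent.trans (acInv1 (v' := x⁻¹ * y * x * y⁻¹ * x)) ?_
  refine IsAndrewsCurtisEquivalent.trans (acConj1 (y⁻¹ * x) (v' := x)) ?_
  refine IsAndrewsCurtisEquivalent.trans (acInv0 (u' := x⁻¹ * y)) ?_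
  refine IsAndrewsCurtisEquivalent.trans (acMul0 (u' := x⁻¹ * y * x)) ?_
  refine IsAndrewsCurtisEquivalent.trans (acConj0 (x) (u' := y)) ?_
  refine IsAndrewsCurtisEquivalent.trans acSwap ?_
  exact IsAndrewsCurtisEquivalent.refl _
/-- **`n = 2` (Gersten): `⟨x, y ∣ yxy = xyx, x³ = y²⟩` — the presentation of `L_{2,1}`, i.e.
the Akbulut–Kirby presentation `AK(2)` up to `x ↔ y` — is Andrews–Curtis trivial.** GST §8
reproduce Gersten's trivialisation [Ge] (multiply `r₀` by `(x³y⁻²)·[(yxy)y⁻²x³(yxy)⁻¹]`, conjugate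
to `x²y⁻¹xy⁻¹x²y⁻¹`, then change basis `z = x²y⁻¹`); here an explicit sequence of 23 of the three
elementary moves (no change of basis; relators of length `≤ 9` throughout), found by breadth-first
search and checked move by move by the kernel. [cite: GompfScharlemannThompson2010, §8 (Gersten's trivialisation of the `L_{2,1}` presentation)] -/
theorem isAndrewsCurtisEquivalent_gstPresentation_two_trivial :
    IsAndrewsCurtisEquivalent (gstPresentation 2) (BalancedPresentation.trivial 2) := by
  set x : FreeGroup (Fin 2) := FreeGroup.of 0
  set y : FreeGroup (Fin 2) := FreeGroup.of 1
  have e : gstPresentation 2 = ![y * x * y * (x * y * x)⁻¹, x ^ (2 + 1) * (y ^ 2)⁻¹] := rfl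
  have fin : BalancedPresentation.trivial 2 = ![x, y] := trivial_two_eq
  rw [e, fin]
  refine IsAndrewsCurtisEquivalent.trans (acInv1 (v' := y * y * x⁻¹ * x⁻¹ * x⁻¹)) ?_
  refine IsAndrewsCurtisEquivalent.trans (acConj1 (y⁻¹ * y⁻¹) (v' := x⁻¹ * x⁻¹ * x⁻¹ * y * y)) ?_
  refine IsAndrewsCurtisEquivalent.trans (acInv0 (u' := x * y * x * y⁻¹ * x⁻¹ * y⁻¹)) ?_
  refine IsAndrewsCurtisEquivalent.trans (acConj0 (x⁻¹ * y⁻¹ * x⁻¹) (u' := y⁻¹ * x⁻¹ * y⁻¹ * x * y * x)) ?_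
  refine IsAndrewsCurtisEquivalent.trans (acMul0 (u' := y⁻¹ * x⁻¹ * y⁻¹ * x * y * x⁻¹ * x⁻¹ * y * y)) ?_
  refine IsAndrewsCurtisEquivalent.trans (acInv1 (v' := y⁻¹ * y⁻¹ * x * x * x)) ?_
  refine IsAndrewsCurtisEquivalent.trans (acConj1 (y) (v' := y⁻¹ * x * x * x * y⁻¹)) ?_
  refine IsAndrewsCurtisEquivalent.trans (acConj0 (x⁻¹ * y * x * y) (u' := y * x⁻¹ * x⁻¹ * y * x⁻¹ * y⁻¹ * x)) ?_
  refine IsAndrewsCurtisEquivalent.trans (acMul1 (v' := y⁻¹ * x * y * x⁻¹ * y⁻¹ * x)) ?_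
  refine IsAndrewsCurtisEquivalent.trans (acConj1 (x⁻¹ * y) (v' := y * x⁻¹ * y⁻¹ * x * y⁻¹ * x)) ?_
  refine IsAndrewsCurtisEquivalent.trans (acInv0 (u' := x⁻¹ * y * x * y⁻¹ * x * x * y⁻¹)) ?_
  refine IsAndrewsCurtisEquivalent.trans (acMul1 (v' := y * x⁻¹ * y⁻¹ * x * x * y⁻¹ * x * x * y⁻¹)) ?_
  refine IsAndrewsCurtisEquivalent.trans (acConj1 (x⁻¹ * x⁻¹ * y * x * y⁻¹) (v' := y⁻¹ * x * y⁻¹ * x * x)) ?_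
  refine IsAndrewsCurtisEquivalent.trans (acInv0 (u' := y * x⁻¹ * x⁻¹ * y * x⁻¹ * y⁻¹ * x)) ?_
  refine IsAndrewsCurtisEquivalent.trans (acConj0 (y⁻¹) (u' := x⁻¹ * x⁻¹ * y * x⁻¹ * y⁻¹ * x * y)) ?_
  refine IsAndrewsCurtisEquivalent.trans (acMul1 (v' := y⁻¹ * y⁻¹ * x * y)) ?_
  refine IsAndrewsCurtisEquivalent.trans (acConj1 (y) (v' := y⁻¹ * x)) ?_
  refine IsAndrewsCurtisEquivalent.trans (acMul0 (u' := x⁻¹ * x⁻¹ * y * x⁻¹ * y⁻¹ * x * x)) ?_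
  refine IsAndrewsCurtisEquivalent.trans (acInv0 (u' := x⁻¹ * x⁻¹ * y * x * y⁻¹ * x * x)) ?_
  refine IsAndrewsCurtisEquivalent.trans (acConj0 (y⁻¹ * x * x) (u' := x)) ?_
  refine IsAndrewsCurtisEquivalent.trans (acInv1 (v' := x⁻¹ * y)) ?_
  refine IsAndrewsCurtisEquivalent.trans (acMul1 (v' := x⁻¹ * y * x)) ?_
  refine IsAndrewsCurtisEquivalent.trans (acConj1 (x) (v' := y)) ?_
  exact IsAndrewsCurtisEquivalent.refl _

/-- **`AK(2) = ⟨x, y ∣ x² = y³, xyx = yxy⟩` (`akbulutKirby 0`) is Andrews–Curtis trivial**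
(Gersten; GST §8), by `isAndrewsCurtisEquivalent_gstPresentation_two_trivial` and the reduction
`isAndrewsCurtisEquivalent_gstPresentation_trivial_iff` of the sibling file (the two presentations
differ by `x ↔ y`, the order of the relators and one inversion). The tree's docstring of
`Literature.Topology.FourManifolds.akbulutKirby` ("for `n ≥ 3` they are not known to be (stably)
Andrews–Curtis trivial") is thus sharp at the bottom: `n = 2` is trivial.
[cite: GompfScharlemannThompson2010, §8] -/
theorem isAndrewsCurtisEquivalent_akbulutKirby_zero_trivial :
    IsAndrewsCurtisEquivalent (akbulutKirby 0) (BalancedPresentation.trivial 2) :=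
  (isAndrewsCurtisEquivalent_gstPresentation_trivial_iff 0).1
    isAndrewsCurtisEquivalent_gstPresentation_two_trivial

/-- **For `n ≤ 2` the GST presentations are Andrews–Curtis trivial** (GST §8: the cases
`n = 0, 1` are "clear", `n = 2` is Gersten's). [cite: GompfScharlemannThompson2010, §8] -/
theorem isAndrewsCurtisEquivalent_gstPresentation_trivial_of_le_two {n : ℕ} (hn : n ≤ 2) :
    IsAndrewsCurtisEquivalent (gstPresentation n) (BalancedPresentation.trivial 2) := by
  obtain rfl | rfl | rfl : n = 0 ∨ n = 1 ∨ n = 2 := by omega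
  · exact isAndrewsCurtisEquivalent_gstPresentation_zero_trivial
  · exact isAndrewsCurtisEquivalent_gstPresentation_one_trivial
  · exact isAndrewsCurtisEquivalent_gstPresentation_two_trivial

/-- **The bound `3 ≤ n` in the barrier's hypothesis is automatic**: some GST presentation is
Andrews–Curtis nontrivial iff some `gstPresentation n` with `n ≥ 3` is
(`Literature.Barriers.SmoothPoincare4.AKPresentationsACNontrivial`), since `n ≤ 2` are trivial.
[cite: GompfScharlemannThompson2010, §7 and §8] -/
theorem akPresentationsACNontrivial_iff_exists :
    AKPresentationsACNontrivial ↔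
      ∃ n : ℕ, ¬ IsAndrewsCurtisEquivalent (gstPresentation n) (BalancedPresentation.trivial 2) := by
  constructor
  · rintro ⟨n, -, hn⟩
    exact ⟨n, hn⟩
  · rintro ⟨n, hn⟩
    refine ⟨n, ?_, hn⟩
    by_contra h
    exact hn (isAndrewsCurtisEquivalent_gstPresentation_trivial_of_le_two (by omega))

/-! ### The barriers are exactly GST's §7 implication -/

variable [SphereEmbedding.SmoothnessFacts] [Knot.TubularNbhd.SmoothnessFacts]

/-- **`StrictPropertyTwoRBarrier` is equivalent to GST's printed §7 implication "Property 2R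
(printed form, `StrictPropertyTwoRConjecture`) ⇒ every `⟨x, y ∣ yxy = xyx, xⁿ⁺¹ = yⁿ⟩` is
Andrews–Curtis trivial"** ("If the 2-component link `L_{n,k}` … can be changed to the unlink by
handle slides, then the dual slides in Figure 9 will trivialize that picture, showing that the above
presentation is Andrews-Curtis trivial"). Backward: an Andrews–Curtis nontrivial `gstPresentation n`
contradicts the triviality the implication yields under Property 2R (this is
`strictPropertyTwoRBarrier_of_gst` of the barrier file). Forward: given the barrier and the printed
Property 2R, a `gstPresentation n` with `n ≥ 3` cannot be Andrews–Curtis nontrivial (that would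
refute Property 2R), and those with `n ≤ 2` are trivial outright
(`isAndrewsCurtisEquivalent_gstPresentation_trivial_of_le_two`, GST §8). Hence an unconditional
`StrictPropertyTwoRBarrier_holds` is the same thing as a proof of the §7 implication: the corrected
barrier entry has one proof obligation, not two. [cite: GompfScharlemannThompson2010, §7 and §8] -/
theorem strictPropertyTwoRBarrier_iff_gst :
    StrictPropertyTwoRBarrier ↔
      (Literature.Topology.FourManifolds.StrictPropertyTwoRConjecture →
        ∀ n : ℕ, IsAndrewsCurtisEquivalent (gstPresentation n) (BalancedPresentation.trivial 2)) := by
  refine ⟨fun hB h2R n ↦ ?_, fun hGST hAC h2R ↦ ?_⟩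
  · by_cases hn : n ≤ 2
    · exact isAndrewsCurtisEquivalent_gstPresentation_trivial_of_le_two hn
    · by_contra hAC
      exact hB ⟨n, by omega, hAC⟩ h2R
  · obtain ⟨n, -, hn⟩ := hAC
    exact hn (hGST h2R n)

/-- The §7 implication under the barrier as hypothesis: **given `StrictPropertyTwoRBarrier` and the
printed Property 2R, every `⟨x, y ∣ yxy = xyx, xⁿ⁺¹ = yⁿ⟩` is Andrews–Curtis trivial**
(`strictPropertyTwoRBarrier_iff_gst`, forward). [cite: GompfScharlemannThompson2010, §7 and §8] -/
theorem isAndrewsCurtisEquivalent_gstPresentation_trivial_of_barrier (hB : StrictPropertyTwoRBarrier)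
    (h2R : Literature.Topology.FourManifolds.StrictPropertyTwoRConjecture) (n : ℕ) :
    IsAndrewsCurtisEquivalent (gstPresentation n) (BalancedPresentation.trivial 2) :=
  strictPropertyTwoRBarrier_iff_gst.1 hB h2R n

-- `linter.deprecated` is switched off for the next declaration only: it characterises the
-- deprecated (misstated, 2026-08-15) `PropertyTwoRBarrier` by the equally deprecated
-- `gst2010_propertyTwoR_andrewsCurtis` (via `propertyTwoRBarrier_of_gst`) and must name all three;
-- it is deprecated with them towards `strictPropertyTwoRBarrier_iff_gst`.
set_option linter.deprecated false in
/-- **DEPRECATED with both of its sides (2026-08-15). `PropertyTwoRBarrier` is equivalent to the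
original (permissive-hypothesis) named fact `gst2010_propertyTwoR_andrewsCurtis`** (both
over-state the source in the same way — Errata and "Deprecation" of the barrier file, where both
are `@[deprecated]` towards the corrected barrier `StrictPropertyTwoRBarrier` — and they do so
together). Backward is `propertyTwoRBarrier_of_gst`; forward as for
`strictPropertyTwoRBarrier_iff_gst`, which is the corrected characterisation to use.
[cite: GompfScharlemannThompson2010, §7 and §8] -/
@[deprecated strictPropertyTwoRBarrier_iff_gst (since := "2026-08-15")]
theorem propertyTwoRBarrier_iff_gst :
    PropertyTwoRBarrier ↔ gst2010_propertyTwoR_andrewsCurtis := by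
  refine ⟨fun hB h2R n ↦ ?_, propertyTwoRBarrier_of_gst⟩
  by_cases hn : n ≤ 2
  · exact isAndrewsCurtisEquivalent_gstPresentation_trivial_of_le_two hn
  · by_contra hAC
    exact hB ⟨n, by omega, hAC⟩ h2R

/-- **Given `StrictPropertyTwoRBarrier` and Andrews–Curtis nontriviality of some
`gstPresentation n` (any `n`: the bound `3 ≤ n` is automatic, `akPresentationsACNontrivial_iff_exists`),
the printed generalised Property R conjecture fails** — it contains the printed Property 2R as the
case `n = 2` (`Literature.Topology.FourManifolds.strictPropertyTwoRConjecture_of_strictGeneralized`);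
GST: "We conclude that the conjecture is probably false".
[cite: GompfScharlemannThompson2010, §1 ("probably false") and §7] -/
theorem not_strictGeneralizedPropertyR_of_barrier (hB : StrictPropertyTwoRBarrier)
    (hAC : ∃ n : ℕ, ¬ IsAndrewsCurtisEquivalent (gstPresentation n) (BalancedPresentation.trivial 2)) :
    ¬ Literature.Topology.FourManifolds.StrictGeneralizedPropertyRConjecture :=
  fun h ↦ hB (akPresentationsACNontrivial_iff_exists.2 hAC)
    (Literature.Topology.FourManifolds.strictPropertyTwoRConjecture_of_strictGeneralized h)

end Literature.Barriers.SmoothPoincare4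

end
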